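import Literature.AnabelianGeometry.SemiGraphs.GeneralizedMorphisms

/-!
# The pull-back functor `B(ℋ) ⥤ B(𝒢)` of a generalized morphism ([SemiAnbd] §2, Remark 2.11.1)

Mochizuki, *Semi-graphs of anabelioids*, Publ. RIMS **42** (2006) 221–322, §2, author's manuscript
p. 32, Remark 2.11.1 [cite: MochizukiSemiAnbd2006, Rem. 2.11.1 p.32]: "every generalized morphism of
semi-graphs of connected anabelioids `Φ : 𝒢 → ℋ` determines, in a natural fashion, a morphism
`B(𝒢) → B(ℋ)` between the associated anabelioids."

This file CONSTRUCTS the pull-back functor `Φ^* : B(ℋ) ⥤ B(𝒢)` of a GENERALIZED morphism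
(`SemiGraphOfAnabelioids.GeneralizedHom`, `GeneralizedMorphisms.lean`, abc-iut-L3-t1), companion to
`PullbackFunctor.lean` (the case of an ordinary morphism):

* `BObj.atC`, `ρC`: the constituent object `A_d` of `A ∈ B(ℋ)` at a component `d` of `ℍ` (vertex or
  edge) and the corresponding restriction functor `ρ_d : B(ℋ) ⥤ ℋ_d`;
* `glueIso q : ρ_{d'} ⋙ (q_*)^* ≅ ρ_d` for an arrow `q : d → d'` of `Cat(ℍ)` — the gluing isomorphisms
  `ψ_b : b^* S_w ⥲ T_f` of the objects of `B(ℋ)` (identity over identities), natural in the object;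
* `GeneralizedHom.gluingIso`, `pullbackObj`, `pullbackMap`, `pullbackFunctor`: at the component
  `c ↦ d = Cat(Φ)(c)` the object `Φ_c^* A_d`; along a branch `b : e → v` of `𝒢`, mapped to the arrow
  `ψ = Cat(Φ)(b) : d → d'`, the gluing `b^* Φ_v^* A_{d'} ≅ Φ_e^* ψ^* A_{d'} ≅ Φ_e^* A_d` given by the
  isomorphism (c) of Definition 2.11 followed by `Φ_e^*` of the gluing of `A` along `ψ`.

Exactness of `Φ^*` (i.e. that it is a morphism of anabelioids) is the named fact
`remark_2_11_1_toB` and is not proved here.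
-/

namespace Literature.AnabelianGeometry.SemiGraphs

open CategoryTheory CategoryTheory.Limits
open Literature.AnabelianGeometry.Anabelioids

universe v₁ u₁ u

namespace SemiGraphOfAnabelioids

variable {ℋ : SemiGraphOfAnabelioids.{v₁, u₁, u}}

/-! ### Constituent objects and restriction functors at a component -/

/-- The constituent object `A_d` of `A = (S_w, T_f, ψ) ∈ B(ℋ)` at a component `d` of `ℍ`: `S_w` at a
vertex, `T_f` at an edge. [cite: MochizukiSemiAnbd2006, Def. 2.1 p.23] -/
def BObj.atC (A : ℋ.BObj) : ∀ d : ℋ.graph.CatCarrier, ℋ.constituent d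
  | Sum.inl w => A.S w
  | Sum.inr f => A.T f

/-- The component at `d` of a morphism of `B(ℋ)`. [cite: MochizukiSemiAnbd2006, Def. 2.1 p.23] -/
def BObj.Hom.atC {A B : ℋ.BObj} (g : A ⟶ B) : ∀ d : ℋ.graph.CatCarrier, A.atC d ⟶ B.atC d
  | Sum.inl w => g.fS w
  | Sum.inr f => g.fT f

variable (ℋ) in
/-- The restriction functor `ρ_d : B(ℋ) ⥤ ℋ_d` at a component `d` (`ρ_w` at a vertex, `ρ_f` at an
edge). [cite: MochizukiSemiAnbd2006, Def. 2.1 p.23] -/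
def ρC (d : ℋ.graph.CatCarrier) : ℋ.BObj ⥤ ℋ.constituent d where
  obj A := A.atC d
  map g := BObj.Hom.atC g d
  map_id A := by cases d <;> rfl
  map_comp f g := by cases d <;> rfl

/-- The gluing of the objects of `B(ℋ)` along a generating arrow `a : d → d'` of `Cat(ℍ)` (a branch
`b : f → w`), as a natural isomorphism `ρ_{d'} ⋙ (a_*)^* ≅ ρ_d` (components `ψ_b : b^* S_w ⥲ T_f`).
[cite: MochizukiSemiAnbd2006, Def. 2.1 p.23] -/
noncomputable def glueArrowIso : ∀ {d d' : ℋ.graph.CatCarrier} (a : d ⟶ d'),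
    ℋ.ρC d' ⋙ arrowMap a ≅ ℋ.ρC d
  | Sum.inr _, Sum.inl w, ⟨b, rfl, hb⟩ =>
      NatIso.ofComponents (fun A => A.ψ b w hb) (fun g => g.comm b w hb)
  | Sum.inl _, Sum.inl _, a => PEmpty.elim a
  | Sum.inl _, Sum.inr _, a => PEmpty.elim a
  | Sum.inr _, Sum.inr _, a => PEmpty.elim a

/-- The gluing of the objects of `B(ℋ)` along an arbitrary arrow `q : d → d'` of `Cat(ℍ)` (a path of
length `≤ 1`), as a natural isomorphism `ρ_{d'} ⋙ (q_*)^* ≅ ρ_d`: the identity over identities, `ψ_b`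
over a branch. [cite: MochizukiSemiAnbd2006, Def. 2.1 p.23] -/
noncomputable def glueIso {d : ℋ.graph.CatCarrier} :
    ∀ {d' : ℋ.graph.CatCarrier} (q : Quiver.Path d d'), ℋ.ρC d' ⋙ atMap q ≅ ℋ.ρC d
  | _, Quiver.Path.nil => Iso.refl _
  | _, Quiver.Path.cons q a => Functor.isoWhiskerRight (glueArrowIso a) (atMap q) ≪≫ glueIso q

namespace GeneralizedHom

variable {𝒢 : SemiGraphOfAnabelioids.{v₁, u₁, u}} (Φ : GeneralizedHom 𝒢 ℋ)

/-- The branch `b` of `e` abutting to `v`, as the arrow `b : e → v` of `Cat(𝔾)`.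
[cite: MochizukiSemiAnbd2006, Def. 2.11 p.32] -/
def _root_.Literature.AnabelianGeometry.SemiGraphs.SemiGraph.branchPath {G : SemiGraph.{u}}
    (b : G.Branch) (v : G.Vertex) (h : G.abuts b = some v) :
    Quiver.Path (V := G.CatCarrier) (Sum.inr (G.edgeOf b)) (Sum.inl v) :=
  Quiver.Hom.toPath (V := G.CatCarrier) (⟨b, rfl, h⟩ : SemiGraph.CatArrow (Sum.inr _) (Sum.inl v))

/-- The gluing of the pull-back along a branch `b` of `e` abutting to `v`, mapped by `Cat(Φ)` to the
arrow `ψ : d → d'`, as a natural isomorphism of functors `B(ℋ) ⥤ 𝒢_e`: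
`ρ_{d'} ⋙ Φ_v^* ⋙ b^* ≅ ρ_{d'} ⋙ ψ^* ⋙ Φ_e^* ≅ ρ_d ⋙ Φ_e^*` (the isomorphism (c) of Definition 2.11,
then `Φ_e^*` of the gluing of `B(ℋ)` along `ψ`). [cite: MochizukiSemiAnbd2006, Rem. 2.11.1 p.32] -/
noncomputable def gluingIso (b : 𝒢.graph.Branch) (v : 𝒢.graph.Vertex)
    (h : 𝒢.graph.abuts b = some v) :
    ℋ.ρC (Φ.functor.obj (Sum.inl v)) ⋙ ((Φ.φ (Sum.inl v)).pullback ⋙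
        atMap (SemiGraph.branchPath b v h)) ≅
      ℋ.ρC (Φ.functor.obj (Sum.inr (𝒢.graph.edgeOf b))) ⋙ (Φ.φ (Sum.inr (𝒢.graph.edgeOf b))).pullback :=
  Functor.isoWhiskerLeft _ (Φ.iso (SemiGraph.branchPath b v h)).symm ≪≫
    Functor.isoWhiskerRight (glueIso (Φ.functor.map (SemiGraph.branchPath b v h)))
      (Φ.φ (Sum.inr (𝒢.graph.edgeOf b))).pullback

/-- The pull-back `Φ^* A ∈ B(𝒢)` of `A ∈ B(ℋ)` along a generalized morphism `Φ : 𝒢 → ℋ`: at the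
component `c ↦ d` the object `Φ_c^* A_d`, glued along the branches by `gluingIso`.
[cite: MochizukiSemiAnbd2006, Rem. 2.11.1 p.32] -/
noncomputable def pullbackObj (A : ℋ.BObj) : 𝒢.BObj where
  S v := (Φ.φ (Sum.inl v)).pullback.obj (A.atC (Φ.functor.obj (Sum.inl v)))
  T e := (Φ.φ (Sum.inr e)).pullback.obj (A.atC (Φ.functor.obj (Sum.inr e)))
  ψ b v h := (Φ.gluingIso b v h).app A

/-- The pull-back along `Φ` of a morphism of `B(ℋ)` (componentwise); compatibility with the gluing is
the naturality of `gluingIso`. [cite: MochizukiSemiAnbd2006, Rem. 2.11.1 p.32] -/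
noncomputable def pullbackMap {A B : ℋ.BObj} (g : A ⟶ B) : Φ.pullbackObj A ⟶ Φ.pullbackObj B where
  fS v := (Φ.φ (Sum.inl v)).pullback.map (BObj.Hom.atC g (Φ.functor.obj (Sum.inl v)))
  fT e := (Φ.φ (Sum.inr e)).pullback.map (BObj.Hom.atC g (Φ.functor.obj (Sum.inr e)))
  comm b v h := (Φ.gluingIso b v h).hom.naturality g

/-- **[SemiAnbd] Remark 2.11.1** (second assertion): the pull-back functor `Φ^* : B(ℋ) ⥤ B(𝒢)` of a
generalized morphism of semi-graphs of anabelioids `Φ : 𝒢 → ℋ` — the functor underlying the morphism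
of anabelioids `B(𝒢) → B(ℋ)` that `Φ` "determines, in a natural fashion" (exactness: the named fact
`remark_2_11_1_toB`). [cite: MochizukiSemiAnbd2006, Rem. 2.11.1 p.32] -/
noncomputable def pullbackFunctor : ℋ.BObj ⥤ 𝒢.BObj where
  obj A := Φ.pullbackObj A
  map g := Φ.pullbackMap g
  map_id A := by
    refine BObj.hom_ext _ _ (funext fun v => ?_) (funext fun e => ?_)
    · change (Φ.φ (Sum.inl v)).pullback.map ((ℋ.ρC _).map (𝟙 A)) = 𝟙 _
      rw [CategoryTheory.Functor.map_id, CategoryTheory.Functor.map_id]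
    · change (Φ.φ (Sum.inr e)).pullback.map ((ℋ.ρC _).map (𝟙 A)) = 𝟙 _
      rw [CategoryTheory.Functor.map_id, CategoryTheory.Functor.map_id]
  map_comp f g := by
    refine BObj.hom_ext _ _ (funext fun v => ?_) (funext fun e => ?_)
    · change (Φ.φ (Sum.inl v)).pullback.map ((ℋ.ρC _).map (f ≫ g)) = _ ≫ _
      rw [CategoryTheory.Functor.map_comp, CategoryTheory.Functor.map_comp]
      rfl
    · change (Φ.φ (Sum.inr e)).pullback.map ((ℋ.ρC _).map (f ≫ g)) = _ ≫ _
      rw [CategoryTheory.Functor.map_comp, CategoryTheory.Functor.map_comp]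
      rfl

/-- Compatibility with restriction: `Φ^* ⋙ ρ_v = ρ_{Cat(Φ)(v)} ⋙ Φ_v^*`.
[cite: MochizukiSemiAnbd2006, Rem. 2.11.1 p.32] -/
theorem pullbackFunctor_comp_ρ (v : 𝒢.graph.Vertex) :
    Φ.pullbackFunctor ⋙ 𝒢.ρ v = ℋ.ρC (Φ.functor.obj (Sum.inl v)) ⋙ (Φ.φ (Sum.inl v)).pullback := rfl

/-- Compatibility with restriction to an edge: `Φ^* ⋙ ρ_e = ρ_{Cat(Φ)(e)} ⋙ Φ_e^*`.
[cite: MochizukiSemiAnbd2006, Rem. 2.11.1 p.32] -/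
theorem pullbackFunctor_comp_ρE (e : 𝒢.graph.Edge) :
    Φ.pullbackFunctor ⋙ 𝒢.ρE e = ℋ.ρC (Φ.functor.obj (Sum.inr e)) ⋙ (Φ.φ (Sum.inr e)).pullback := rfl

end GeneralizedHom

end SemiGraphOfAnabelioids

end Literature.AnabelianGeometry.SemiGraphs
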